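import Mathlib.MeasureTheory.Measure.LevyConvergence
import Mathlib.Probability.Distributions.Gaussian.Real
import Summits.RiemannHypothesis.RiemannHypothesis.Theorems.LeeYangLeeyangThesisStubStepApprox
import Summits.RiemannHypothesis.RiemannHypothesis.Theorems.LeeYangLeeyangThesisStubPhiMono
import Summits.RiemannHypothesis.RiemannHypothesis.Theorems.LeeYangLeeyangThesisStubStringSteps
import Summits.RiemannHypothesis.RiemannHypothesis.Theorems.LeeYangLeeyangThesisStubChainMarkovPlain
import Literature.Analysis.InverseSpectral.KreinStringWeylSolution
import Literature.Analysis.InverseSpectral.KreinStringContinuity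
import Literature.Probability.LatticeModels.IsingLimitLawLaplace
import HarnessLib

/-!
# RiemannHypothesis / LeeYang — crux `LeeyangThesis`, line `Sketch`: the glue B1

The registered stub `stub_B1` of skeleton `Cruxes/LeeyangThesis/Lines/Sketch.lean` — B1: "laws
with Gaussian moments whose two-sided Laplace transform is the end value of a finite-length Kreĭn
string with non-decreasing density are Ising limit laws" — PROVED by gluing the landed stubs
`stub_stepApprox` (lower step strings), `stub_stringSteps` + `stub_chainMarkovPlain` (the chain ↔ step-string
dictionary) and `stub_phiMono` (monotonicity in the mass) with Lévy's convergence theorem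
(`MeasureTheory.ProbabilityMeasure.tendsto_of_tendsto_charFun`) and the Gaussian-average identity
`∫ e^{bu²} dμ = E_G ∫ e^{√(2b) G u} dμ` (Tonelli) for the uniform Gaussian-moment bound.
-/

noncomputable section

-- single-problem summit namespace `Summit.RiemannHypothesis.RiemannHypothesis.…` (D-0017)
set_option linter.dupNamespace false

open MeasureTheory Filter Topology Complex Set
open scoped ENNReal
open Literature.Analysis.InverseSpectral Literature.Probability.LatticeModels ProbabilityTheory

namespace Summit.RiemannHypothesis.RiemannHypothesis.Theorems.LeeYangTelegraphString

/-! ### Step strings exist -/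

/-- For breakpoints `s_j ≥ 0` and increments `d_j ≥ 0` there is a Kreĭn string of infinite length
with mass density `Σ_j d_j 𝟙[s_j ≤ ·]` (a "step string"). [folklore] -/
theorem exists_stepString (N : ℕ) (s d : Fin N → ℝ) (hs : ∀ j, 0 ≤ s j) (hd : ∀ j, 0 ≤ d j) :
    ∃ T : KreinString, T.length = ⊤ ∧ T.massMeasure = volume.withDensity
      (fun y => ENNReal.ofReal (∑ j : Fin N, (Set.Ici (s j)).indicator (fun _ => d j) y)) := by
  set f : ℝ → ℝ≥0∞ :=
    fun y => ENNReal.ofReal (∑ j : Fin N, (Set.Ici (s j)).indicator (fun _ => d j) y) with hf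
  have hf_neg : ∀ y < 0, f y = 0 := by
    intro y hy
    simp only [hf]
    rw [Finset.sum_eq_zero, ENNReal.ofReal_zero]
    intro j _
    rw [Set.indicator_of_notMem]
    simp only [Set.mem_Ici, not_le]
    exact hy.trans_le (hs j)
  have hf_le : ∀ y, f y ≤ (Set.Ici (0 : ℝ)).indicator (fun _ => ENNReal.ofReal (∑ j, d j)) y := by
    intro y
    by_cases hy : y < 0
    · rw [hf_neg y hy]; exact bot_le
    · rw [Set.indicator_of_mem (show y ∈ Set.Ici (0 : ℝ) from not_lt.1 hy)]
      refine ENNReal.ofReal_le_ofReal (Finset.sum_le_sum fun j _ => ?_)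
      exact Set.indicator_le_self' (fun _ _ => hd j) y
  refine ⟨⟨⊤, by simp, volume.withDensity f, ?_, ?_, ?_⟩, rfl, rfl⟩
  · rw [withDensity_apply _ measurableSet_Iio]
    rw [setLIntegral_congr_fun measurableSet_Iio (fun y hy => hf_neg y hy)]
    simp
  · intro x _
    rw [withDensity_apply _ measurableSet_Iic]
    calc ∫⁻ y in Set.Iic x, f y
        ≤ ∫⁻ y in Set.Iic x, (Set.Ici (0 : ℝ)).indicator (fun _ => ENNReal.ofReal (∑ j, d j)) y :=
          lintegral_mono fun y => hf_le y
      _ = ENNReal.ofReal (∑ j, d j) * volume (Set.Ici (0 : ℝ) ∩ Set.Iic x) := by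
          rw [lintegral_indicator_const measurableSet_Ici, Measure.restrict_apply measurableSet_Ici]
      _ < ⊤ := by
          rw [Set.Ici_inter_Iic, Real.volume_Icc]
          exact ENNReal.mul_lt_top ENNReal.ofReal_lt_top ENNReal.ofReal_lt_top
  · intro x hx
    exact absurd hx (by simp)

/-! ### Gaussian average -/

/-- `e^{b u²} = ∫ e^{√(2b) u g} dγ(g)` for the standard Gaussian `γ` and `b ≥ 0`, as a lower
Lebesgue integral. [folklore] -/
theorem lintegral_gaussian_exp_mul (b : ℝ) (hb : 0 ≤ b) (u : ℝ) :
    ∫⁻ g, ENNReal.ofReal (Real.exp (Real.sqrt (2 * b) * u * g)) ∂(gaussianReal 0 1) =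
      ENNReal.ofReal (Real.exp (b * u ^ 2)) := by
  have hint := integrable_exp_mul_gaussianReal (μ := 0) (v := 1) (Real.sqrt (2 * b) * u)
  rw [← ofReal_integral_eq_lintegral_ofReal hint (Eventually.of_forall fun g => (Real.exp_pos _).le)]
  congr 1
  have h := congrFun (mgf_id_gaussianReal (μ := 0) (v := 1)) (Real.sqrt (2 * b) * u)
  simp only [mgf, id] at h
  rw [h]
  congr 1
  have : Real.sqrt (2 * b) ^ 2 = 2 * b := Real.sq_sqrt (by linarith)
  push_cast
  rw [zero_mul, zero_add, one_mul, mul_pow, this]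
  ring

/-- The Gaussian average of the Laplace transform is the Gaussian moment:
`∫⁻ e^{b u²} dμ = ∫⁻_g ∫⁻_u e^{√(2b) g u} dμ dγ` for every s-finite measure `μ` on `ℝ` and `b ≥ 0`.
[folklore] -/
theorem lintegral_exp_mul_sq_eq_gaussian_average (μ : Measure ℝ) [SFinite μ] (b : ℝ) (hb : 0 ≤ b) :
    ∫⁻ u, ENNReal.ofReal (Real.exp (b * u ^ 2)) ∂μ =
      ∫⁻ g, ∫⁻ u, ENNReal.ofReal (Real.exp (Real.sqrt (2 * b) * g * u)) ∂μ ∂(gaussianReal 0 1) := by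
  have hmeas : AEMeasurable (Function.uncurry fun (u g : ℝ) =>
      ENNReal.ofReal (Real.exp (Real.sqrt (2 * b) * g * u))) (μ.prod (gaussianReal 0 1)) := by
    refine (ENNReal.measurable_ofReal.comp ?_).aemeasurable
    exact Real.measurable_exp.comp ((measurable_const.mul measurable_snd).mul measurable_fst)
  rw [← lintegral_lintegral_swap hmeas]
  refine lintegral_congr fun u => ?_
  rw [← lintegral_gaussian_exp_mul b hb u]
  refine lintegral_congr fun g => ?_
  simp only [mul_right_comm]

/-- Exponential moments from one Gaussian moment: `e^{ru}` is integrable whenever `e^{u²}` is.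
[folklore] -/
theorem integrable_exp_mul_of_exp_sq {ν : Measure ℝ}
    (h : Integrable (fun u : ℝ => Real.exp (1 * u ^ 2)) ν) (r : ℝ) :
    Integrable (fun u : ℝ => Real.exp (r * u)) ν := by
  refine (h.const_mul (Real.exp (r ^ 2 / 4))).mono'
    (by fun_prop : Continuous fun u : ℝ => Real.exp (r * u)).aestronglyMeasurable
    (Eventually.of_forall fun u => ?_)
  rw [Real.norm_eq_abs, abs_of_pos (Real.exp_pos _), one_mul]
  calc Real.exp (r * u) ≤ Real.exp (|r| * |u|) :=
        Real.exp_le_exp.2 (by rw [← abs_mul]; exact le_abs_self _)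
    _ ≤ Real.exp (|r| ^ 2 / 4) * Real.exp (u ^ 2) := exp_mul_abs_le |r| u
    _ = Real.exp (r ^ 2 / 4) * Real.exp (u ^ 2) := by rw [sq_abs]

/-- The same for the complex kernel `e^{ru}`, `r` real. [folklore] -/
theorem integrable_cexp_mul_of_exp_sq {ν : Measure ℝ}
    (h : Integrable (fun u : ℝ => Real.exp (1 * u ^ 2)) ν) (r : ℝ) :
    Integrable (fun u : ℝ => cexp ((r : ℂ) * u)) ν := by
  refine (integrable_exp_mul_of_exp_sq h r).mono'
    (by fun_prop : Continuous fun u : ℝ => cexp ((r : ℂ) * u)).aestronglyMeasurable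
    (Eventually.of_forall fun u => ?_)
  rw [Complex.norm_exp, show ((r : ℂ) * (u : ℂ)).re = r * u by simp]

/-- Real and complex Laplace kernels: `∫ e^{ru} dμ = Re ∫ e^{ru} dμ` (`r` real). [folklore] -/
theorem integral_exp_mul_eq_re {μ : Measure ℝ} (r : ℝ)
    (h : Integrable (fun u : ℝ => cexp ((r : ℂ) * u)) μ) :
    ∫ u, Real.exp (r * u) ∂μ = (∫ u, cexp ((r : ℂ) * u) ∂μ).re := by
  have h1 := integral_re h
  simp only [RCLike.re_to_complex] at h1
  rw [← h1]
  refine integral_congr_ae (Eventually.of_forall fun u => ?_)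
  dsimp only
  rw [show (r : ℂ) * (u : ℂ) = ((r * u : ℝ) : ℂ) by push_cast; ring, Complex.exp_ofReal_re]

/-! ### B1 from the dictionary -/

/-- **Stub B1 — convex-string laws are Ising limit laws (glue).** If `S` is a Kreĭn string of
finite length `L` with mass `ρ(y) dy` on `(-∞, L)`, `ρ` measurable, non-decreasing on `(-∞, L)`, zero
on `(-∞, 0)`, and `ν` is a probability law with all Gaussian moments whose two-sided Laplace
transform is the end value `lim_{x → L⁻} φ_S(x, -h²)` for every `h ∈ ℂ`, then `ν` is an Ising limit
law: along `x_k = S.exhaust k`, the lower step strings of `stub_stepApprox` are finite ferromagnetic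
chains (`stub_chainMarkovPlain` + `stub_stringSteps`) whose laws converge weakly to `ν` by Lévy's theorem
and have Gaussian moments bounded by those of `ν` (`stub_phiMono`, monotonicity of `φ(·, -σ)` in
`x`, Gaussian average, Tonelli). (No route-file import: the closure is churn-free.) [folklore] -/
theorem stub_B1 : ∀ (S : KreinString) (L : ℝ) (ρ : ℝ → ℝ), 0 < L → Measurable ρ →
    MonotoneOn ρ (Set.Iio L) → (∀ y < 0, ρ y = 0) → S.length = ENNReal.ofReal L →
    S.massMeasure = (volume.withDensity fun y => ENNReal.ofReal (ρ y)).restrict (Set.Iio L) →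
    ∀ ν : ProbabilityMeasure ℝ,
      (∀ b : ℝ, Integrable (fun u : ℝ => Real.exp (b * u ^ 2)) (ν : Measure ℝ)) →
      (∀ h : ℂ, Tendsto (fun x => S.phi (-h ^ 2) x) S.toEnd (𝓝 (∫ u, cexp (h * u) ∂(ν : Measure ℝ)))) →
      IsIsingLimitLaw ν := by
  intro S L ρ hL hρm hmono hρ0 hlen hmass ν hmom hlim
  -- the exhausting points `x k ∈ [0, L)`, `x k → L⁻`
  set x : ℕ → ℝ := S.exhaust with hx
  have hxdom : ∀ k, x k ∈ S.dom := S.exhaust_mem_dom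
  -- lower step data at `x k`, tolerance `1/(k+1)`, radius `k+1`
  have happ := fun k => stub_stepApprox S L ρ hL hρm hmono hρ0 hlen hmass (x k) (hxdom k)
    (1 / ((k : ℝ) + 1)) (by positivity) ((k : ℝ) + 1)
  choose N s d hsmono hs0 hsx hd hT using happ
  -- the step strings
  have hTex : ∀ k, ∃ T : KreinString, T.length = ⊤ ∧ T.massMeasure = volume.withDensity
      (fun y => ENNReal.ofReal (∑ j : Fin (N k), (Set.Ici (s k j)).indicator (fun _ => d k j) y)) :=
    fun k => exists_stepString (N k) (s k) (d k) (hs0 k) (fun j => (hd k j).le)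
  choose T hTlen hTmass using hTex
  have hTdom : ∀ k, x k ∈ (T k).dom := fun k => ⟨(hxdom k).1, by simp [hTlen k]⟩
  have hdomin : ∀ k, (T k).massMeasure.restrict (Set.Iic (x k)) ≤
      S.massMeasure.restrict (Set.Iic (x k)) := fun k => (hT k (T k) (hTlen k) (hTmass k)).1
  have hclose : ∀ k : ℕ, ∀ z : ℂ, ‖z‖ ≤ (k : ℝ) + 1 →
      ‖(T k).phi z (x k) - S.phi z (x k)‖ ≤ 1 / ((k : ℝ) + 1) :=
    fun k => (hT k (T k) (hTlen k) (hTmass k)).2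
  -- piece data of the step string `T k` at the point `x k`
  set ℓ : ∀ k, Fin (N k) → ℝ := fun k j =>
    (if hj : (j : ℕ) + 1 < N k then s k ⟨(j : ℕ) + 1, hj⟩ else x k) - s k j with hℓ
  set P : ∀ k, Fin (N k) → ℝ := fun k j => Real.sqrt (∑ i ∈ Finset.Iic j, d k i) with hP
  have hℓ0 : ∀ k j, 0 ≤ ℓ k j := by
    intro k j
    simp only [hℓ]
    split_ifs with hj
    · exact sub_nonneg.2 ((hsmono k).monotone (Fin.le_iff_val_le_val.2 (Nat.le_succ _)))
    · exact sub_nonneg.2 (hsx k j)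
  have hPpos : ∀ k j, 0 < P k j := by
    intro k j
    simp only [hP]
    refine Real.sqrt_pos.2 (Finset.sum_pos (fun i _ => hd k i) ⟨j, Finset.mem_Iic.2 le_rfl⟩)
  have hPmono : ∀ k, StrictMono (P k) := by
    intro k i j hij
    simp only [hP]
    refine Real.sqrt_lt_sqrt (Finset.sum_nonneg fun i _ => (hd k i).le) ?_
    refine Finset.sum_lt_sum_of_subset (Finset.Iic_subset_Iic.2 hij.le) (i := j)
      (Finset.mem_Iic.2 le_rfl) (fun h => (not_le.2 hij) (Finset.mem_Iic.1 h)) (hd k j)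
      (fun i _ _ => (hd k i).le)
  -- the chains
  have hchain := fun k => stub_chainMarkovPlain (N k) (ℓ k) (P k) (hℓ0 k) (hPpos k) (hPmono k)
  choose n J w hJ hw hmgf using hchain
  -- dictionary: the Laplace transform of the `k`-th chain is `φ_{T k}(x k, -h²)`
  have hdict : ∀ k (h : ℂ), ∫ u, cexp (h * u) ∂(isingMagnetizationLaw (n k) (J k) (w k) : Measure ℝ) =
      (T k).phi (-h ^ 2) (x k) := by
    intro k h
    rw [hmgf k h, stub_stringSteps (N k) (s k) (d k) (hsmono k) (hs0 k) (hd k) (T k) (hTlen k)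
      (hTmass k) (x k) (hxdom k).1 (hsx k) h]
  refine ⟨n, J, w, hJ, hw, ?_, ?_⟩
  · -- weak convergence by Lévy's theorem
    refine ProbabilityMeasure.tendsto_of_tendsto_charFun fun t => ?_
    have hcf : ∀ μ : Measure ℝ, charFun μ t = ∫ u, cexp ((t : ℂ) * I * u) ∂μ := by
      intro μ
      rw [charFun_apply_real]
      refine integral_congr_ae (Eventually.of_forall fun u => ?_)
      simp only [mul_right_comm]
    have hz : -((t : ℂ) * I) ^ 2 = ((t ^ 2 : ℝ) : ℂ) := by
      push_cast
      rw [mul_pow, Complex.I_sq]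
      ring
    have hnorm : ‖((t ^ 2 : ℝ) : ℂ)‖ = t ^ 2 := by
      rw [Complex.norm_real, Real.norm_eq_abs, abs_of_nonneg (sq_nonneg t)]
    -- the limit term
    have h1 : Tendsto (fun k => S.phi ((t ^ 2 : ℝ) : ℂ) (x k)) atTop (𝓝 (charFun (ν : Measure ℝ) t)) := by
      rw [hcf]
      have := (hlim ((t : ℂ) * I)).comp S.tendsto_exhaust
      simpa only [hz, Function.comp_def] using this
    -- the error term
    have h2 : Tendsto (fun k => (T k).phi ((t ^ 2 : ℝ) : ℂ) (x k) - S.phi ((t ^ 2 : ℝ) : ℂ) (x k))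
        atTop (𝓝 0) := by
      rw [tendsto_zero_iff_norm_tendsto_zero]
      have hbound : ∀ᶠ k : ℕ in atTop, ‖(T k).phi ((t ^ 2 : ℝ) : ℂ) (x k) -
          S.phi ((t ^ 2 : ℝ) : ℂ) (x k)‖ ≤ 1 / ((k : ℝ) + 1) := by
        obtain ⟨K, hK⟩ := exists_nat_ge (t ^ 2)
        refine eventually_atTop.2 ⟨K, fun k hk => hclose k _ ?_⟩
        rw [hnorm]
        exact hK.trans (by exact_mod_cast Nat.le_succ_of_le hk)
      refine squeeze_zero' (Eventually.of_forall fun k => norm_nonneg _) hbound ?_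
      exact tendsto_one_div_add_atTop_nhds_zero_nat
    have h3 := h2.add h1
    rw [zero_add] at h3
    refine h3.congr fun k => ?_
    rw [hcf, hdict, hz]
    ring
  · -- uniform Gaussian moments
    intro b
    by_cases hb : b ≤ 0
    · refine ⟨1, fun k => ?_⟩
      calc ∫ u, Real.exp (b * u ^ 2) ∂(isingMagnetizationLaw (n k) (J k) (w k) : Measure ℝ)
          ≤ ∫ _u, (1 : ℝ) ∂(isingMagnetizationLaw (n k) (J k) (w k) : Measure ℝ) := by
            refine integral_mono (integrable_isingMagnetizationLaw _ _
              (by fun_prop : Continuous fun u : ℝ => Real.exp (b * u ^ 2)).stronglyMeasurable)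
              (integrable_const _) fun u => ?_
            exact Real.exp_le_one_iff.2 (mul_nonpos_of_nonpos_of_nonneg hb (sq_nonneg u))
        _ = 1 := by simp
    push Not at hb
    refine ⟨∫ u, Real.exp (b * u ^ 2) ∂(ν : Measure ℝ), fun k => ?_⟩
    set μ : Measure ℝ := (isingMagnetizationLaw (n k) (J k) (w k) : Measure ℝ) with hμ
    have htoEnd : S.toEnd = 𝓝[<] L := by
      simp [KreinString.toEnd, hlen, ENNReal.toReal_ofReal hL.le]
    haveI : S.toEnd.NeBot := by rw [htoEnd]; infer_instance
    -- real Laplace transforms: chain `≤` string `S` at `x k` `≤` limit law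
    have hreal : ∀ r : ℝ, ∫ u, Real.exp (r * u) ∂μ ≤ ∫ u, Real.exp (r * u) ∂(ν : Measure ℝ) := by
      intro r
      have hr2 : -(r : ℂ) ^ 2 = -((r ^ 2 : ℝ) : ℂ) := by push_cast; ring
      -- the chain side is `Re φ_{T k}(x k, -r²)`
      have hL' : ∫ u, Real.exp (r * u) ∂μ = ((T k).phi (-((r ^ 2 : ℝ) : ℂ)) (x k)).re := by
        rw [integral_exp_mul_eq_re r (integrable_isingMagnetizationLaw _ _
          (by fun_prop : Continuous fun u : ℝ => cexp ((r : ℂ) * u)).stronglyMeasurable),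
          hdict k (r : ℂ), hr2]
      -- the limit side is `Re ∫ e^{ru} dν`
      have hR' : ∫ u, Real.exp (r * u) ∂(ν : Measure ℝ) =
          (∫ u, cexp ((r : ℂ) * u) ∂(ν : Measure ℝ)).re :=
        integral_exp_mul_eq_re r (integrable_cexp_mul_of_exp_sq (by simpa using hmom 1) r)
      rw [hL', hR']
      -- `φ_{T k} ≤ φ_S` at `x k` by the mass comparison
      have hmonoT : ((T k).phi (-((r ^ 2 : ℝ) : ℂ)) (x k)).re ≤
          (S.phi (-((r ^ 2 : ℝ) : ℂ)) (x k)).re :=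
        stub_phiMono S (T k) (x k) (hxdom k) (hTdom k) (hdomin k) (r ^ 2) (sq_nonneg r) (x k)
          ⟨(hxdom k).1, le_rfl⟩
      refine hmonoT.trans ?_
      -- `φ_S(x k, -r²) ≤ lim_{x → L⁻} φ_S(x, -r²) = ∫ e^{ru} dν` by monotonicity in `x`
      have hlimr : Tendsto (fun y => (S.phi (-((r ^ 2 : ℝ) : ℂ)) y).re) S.toEnd
          (𝓝 (∫ u, cexp ((r : ℂ) * u) ∂(ν : Measure ℝ)).re) := by
        have := (Complex.continuous_re.tendsto _).comp (hlim (r : ℂ))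
        rw [hr2] at this
        exact this
      refine ge_of_tendsto hlimr ?_
      filter_upwards [S.eventually_mem_dom_ge (hxdom k)] with y hy
      exact S.monotoneOn_phi_neg_re (sq_nonneg r) (hxdom k) hy.1 hy.2
    -- Gaussian average on both sides
    have hfin : ∫⁻ u, ENNReal.ofReal (Real.exp (b * u ^ 2)) ∂μ ≤
        ENNReal.ofReal (∫ u, Real.exp (b * u ^ 2) ∂(ν : Measure ℝ)) := by
      rw [ofReal_integral_eq_lintegral_ofReal (hmom b)
        (Eventually.of_forall fun u => (Real.exp_pos _).le),
        lintegral_exp_mul_sq_eq_gaussian_average μ b hb.le,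
        lintegral_exp_mul_sq_eq_gaussian_average (ν : Measure ℝ) b hb.le]
      refine lintegral_mono fun g => ?_
      have hi1 : Integrable (fun u => Real.exp (Real.sqrt (2 * b) * g * u)) μ :=
        integrable_isingMagnetizationLaw _ _
          (by fun_prop : Continuous fun u : ℝ => Real.exp (Real.sqrt (2 * b) * g * u)).stronglyMeasurable
      have hi2 : Integrable (fun u => Real.exp (Real.sqrt (2 * b) * g * u)) (ν : Measure ℝ) :=
        integrable_exp_mul_of_exp_sq (by simpa using hmom 1) _
      rw [← ofReal_integral_eq_lintegral_ofReal hi1 (Eventually.of_forall fun u => (Real.exp_pos _).le),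
        ← ofReal_integral_eq_lintegral_ofReal hi2 (Eventually.of_forall fun u => (Real.exp_pos _).le)]
      exact ENNReal.ofReal_le_ofReal (hreal (Real.sqrt (2 * b) * g))
    have hik : Integrable (fun u => Real.exp (b * u ^ 2)) μ :=
      integrable_isingMagnetizationLaw _ _
        (by fun_prop : Continuous fun u : ℝ => Real.exp (b * u ^ 2)).stronglyMeasurable
    have hC0 : 0 ≤ ∫ u, Real.exp (b * u ^ 2) ∂(ν : Measure ℝ) :=
      integral_nonneg fun u => (Real.exp_pos _).le
    rw [← ENNReal.ofReal_le_ofReal_iff hC0, ofReal_integral_eq_lintegral_ofReal hik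
      (Eventually.of_forall fun u => (Real.exp_pos _).le)]
    exact hfin

end Summit.RiemannHypothesis.RiemannHypothesis.Theorems.LeeYangTelegraphString

end
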